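import Mathlib.MeasureTheory.Integral.DominatedConvergence
import Literature.Analysis.FluidPDE.EnergyUniqueness
import Literature.Analysis.FluidPDE.WholeSpaceIBP
import Summits.NavierStokesRegularity.NavierStokesRegularity.Theorems.HardyPointSinkHardyBalanceLawWeights
import Summits.NavierStokesRegularity.NavierStokesRegularity.Theorems.HardyPointSinkHardyBalanceLawIntegrability
import HarnessLib

/-!
# Route HardyPointSink — `HardyBalanceLaw`: the cut-off error terms vanish

Helper file for item stmt-NavierStokesRegularity-8388 (`HardyBalanceLaw`). In the local energy
identity tested against `ψ_n(x) = regKernel aₙ (x - x₀) χₙ(x)`, with `aₙ = (n+1)⁻²` and `χₙ` a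
smooth cut-off equal to `1` on `B̄(x₀, n+1)`, vanishing off `B(x₀, 2(n+1))`, with
`‖Dχₙ‖ ≤ C₁/(n+1)` and `|Δχₙ| ≤ C₂/(n+1)²`, four terms carry derivatives of `χₙ` or the factor
`1 - χₙ`; they are supported in `{‖x - x₀‖ ≥ n+1}` and tend to `0` by dominated convergence:

* the bump tail `∫ regBump aₙ (x - x₀) (1 - χₙ) G`;
* the cross term `∫ (Σᵢ ∂ᵢφₙ ∂ᵢχₙ) G`;
* the cut-off Laplacian term `∫ Δχₙ φₙ G`;
* the cut-off gradient term `∫ φₙ Dχₙ(v) S`,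

for continuous `G = O((1+‖x‖)⁻⁴)`, `v = O((1+‖x‖)⁻²)`, `S = O(1)`; each with its uniform bound.
-/

noncomputable section

open MeasureTheory Metric Set Filter Topology TopologicalSpace Function InnerProductSpace
open Literature.Analysis.PDE Literature.Analysis.FluidPDE
open scoped RealInnerProductSpace Laplacian NNReal Interval ContDiff

set_option linter.dupNamespace false -- nested layout Summit.<S>.<Sub>, Sub = S (D-0017)

namespace Summit.NavierStokesRegularity.NavierStokesRegularity.Theorems

/-! ### The bump tail -/

/-- **The bump tail vanishes**: `∫ regBump aₙ (x - x₀) (1 - χₙ) G → 0` with the uniform bound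
`3B ∫ (1+‖x‖)⁻⁴`, for `G` continuous with `|G| ≤ B (1+‖x‖)⁻⁴` and cut-offs `χₙ ∈ [0,1]` equal
to `1` on `B̄(x₀, n+1)`. -/
theorem hardyPointSink_tendsto_bump_tail (x₀ : EuclideanSpace ℝ (Fin 3))
    {χ : ℕ → (EuclideanSpace ℝ (Fin 3)) → ℝ} (hχc : ∀ n, Continuous (χ n))
    (hχ0 : ∀ n x, 0 ≤ χ n x) (hχ1 : ∀ n x, χ n x ≤ 1)
    (hχone : ∀ (n : ℕ) (x : EuclideanSpace ℝ (Fin 3)), dist x x₀ ≤ (n : ℝ) + 1 → χ n x = 1)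
    {G : (EuclideanSpace ℝ (Fin 3)) → ℝ} (hG : Continuous G) {B : ℝ}
    (hGB : ∀ x, |G x| ≤ B * ((1 + ‖x‖) ^ 4)⁻¹) :
    Tendsto (fun n : ℕ => ∫ x, Newtonian.regBump ((((n : ℝ) + 1)⁻¹) ^ 2) (x - x₀) *
        (1 - χ n x) * G x) atTop (𝓝 0) ∧
      (∀ n : ℕ, |∫ x, Newtonian.regBump ((((n : ℝ) + 1)⁻¹) ^ 2) (x - x₀) * (1 - χ n x) * G x| ≤
        3 * B * ∫ x : EuclideanSpace ℝ (Fin 3), ((1 + ‖x‖) ^ 4)⁻¹) ∧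
      ∀ n : ℕ, Integrable (fun x => Newtonian.regBump ((((n : ℝ) + 1)⁻¹) ^ 2) (x - x₀) *
        (1 - χ n x) * G x) := by
  have hKc : ∀ n : ℕ, Continuous fun x : EuclideanSpace ℝ (Fin 3) =>
      Newtonian.regBump ((((n : ℝ) + 1)⁻¹) ^ 2) (x - x₀) := fun n =>
    ((Newtonian.contDiff_regBump (hardyPointSink_seq_pos n) (m := 0)).continuous).comp
      (continuous_id.sub continuous_const)
  have key := hardyPointSink_dct_zero
    (F := fun n x => Newtonian.regBump ((((n : ℝ) + 1)⁻¹) ^ 2) (x - x₀) * (1 - χ n x) * G x)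
    (bound := fun x => 3 * B * ((1 + ‖x‖) ^ 4)⁻¹)
    (fun n => (((hKc n).mul (continuous_const.sub (hχc n))).mul hG).aestronglyMeasurable)
    (hardyPointSink_integrable_F0.const_mul _) ?_ ?_
  · rw [integral_const_mul] at key
    exact key
  · intro n
    refine Eventually.of_forall fun x => ?_
    have hB4 : 0 ≤ B * ((1 + ‖x‖) ^ 4)⁻¹ := (abs_nonneg _).trans (hGB x)
    by_cases hx : dist x x₀ ≤ (n : ℝ) + 1
    · rw [hχone n x hx, sub_self, mul_zero, zero_mul, norm_zero]
      linarith
    · have hr1 : 1 ≤ ‖x - x₀‖ := hardyPointSink_one_le_norm_sub (not_le.mp hx).le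
      have hx' : x - x₀ ≠ 0 := by
        intro h; rw [h, norm_zero] at hr1; linarith
      have hK0 : 0 ≤ Newtonian.regBump ((((n : ℝ) + 1)⁻¹) ^ 2) (x - x₀) :=
        hardyPointSink_regBump_nonneg (hardyPointSink_seq_pos n).le _
      have hK3 : Newtonian.regBump ((((n : ℝ) + 1)⁻¹) ^ 2) (x - x₀) ≤ 3 := by
        refine (hardyPointSink_regBump_le (hardyPointSink_seq_pos n).le hx').trans ?_
        have h5 : (‖x - x₀‖ ^ 5)⁻¹ ≤ 1 := inv_le_one_of_one_le₀ (one_le_pow₀ hr1)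
        have h6 := hardyPointSink_seq_le_one n
        calc 3 * (((n : ℝ) + 1)⁻¹) ^ 2 * (‖x - x₀‖ ^ 5)⁻¹ ≤ 3 * 1 * 1 := by
              gcongr
          _ = 3 := by ring
      have h1χ : |1 - χ n x| ≤ 1 := by
        rw [abs_le]; constructor <;> linarith [hχ0 n x, hχ1 n x]
      rw [Real.norm_eq_abs, abs_mul, abs_mul, abs_of_nonneg hK0]
      calc Newtonian.regBump ((((n : ℝ) + 1)⁻¹) ^ 2) (x - x₀) * |1 - χ n x| * |G x|
          ≤ 3 * 1 * (B * ((1 + ‖x‖) ^ 4)⁻¹) :=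
            mul_le_mul (mul_le_mul hK3 h1χ (abs_nonneg _) (by norm_num)) (hGB x) (abs_nonneg _)
              (by norm_num)
        _ = 3 * B * ((1 + ‖x‖) ^ 4)⁻¹ := by ring
  · intro x
    filter_upwards [hardyPointSink_eventually_dist_lt x₀ x] with n hn
    rw [hχone n x hn.le, sub_self, mul_zero, zero_mul]

/-! ### The cross term `Σᵢ ∂ᵢφₙ ∂ᵢχₙ` -/

/-- **The cross term vanishes**: `∫ (Σᵢ Dφₙ(eᵢ) Dχₙ(eᵢ)) G → 0`, uniform bound
`3 C₁ B ∫ (1+‖x‖)⁻⁴`, where `φₙ = regKernel aₙ (· - x₀)`, `‖Dχₙ‖ ≤ C₁/(n+1)` and `Dχₙ = 0`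
on `B(x₀, n+1)`. -/
theorem hardyPointSink_tendsto_cross_term (x₀ : EuclideanSpace ℝ (Fin 3))
    {χ : ℕ → (EuclideanSpace ℝ (Fin 3)) → ℝ}
    (hχc : ∀ n, ContDiff ℝ 1 (χ n)) {C₁ : ℝ}
    (hχD : ∀ (n : ℕ) (x : EuclideanSpace ℝ (Fin 3)), ‖fderiv ℝ (χ n) x‖ ≤ C₁ / ((n : ℝ) + 1))
    (hχDz : ∀ (n : ℕ) (x : EuclideanSpace ℝ (Fin 3)), dist x x₀ < (n : ℝ) + 1 → fderiv ℝ (χ n) x = 0)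
    {G : (EuclideanSpace ℝ (Fin 3)) → ℝ} (hG : Continuous G) {B : ℝ}
    (hGB : ∀ x, |G x| ≤ B * ((1 + ‖x‖) ^ 4)⁻¹) :
    Tendsto (fun n : ℕ => ∫ x, (∑ i, fderiv ℝ (fun y : EuclideanSpace ℝ (Fin 3) => Newtonian.regKernel
        ((((n : ℝ) + 1)⁻¹) ^ 2) (y - x₀)) x (stdOrthonormalBasis ℝ (EuclideanSpace ℝ (Fin 3)) i) *
        fderiv ℝ (χ n) x (stdOrthonormalBasis ℝ (EuclideanSpace ℝ (Fin 3)) i)) * G x) atTop (𝓝 0) ∧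
      (∀ n : ℕ, |∫ x, (∑ i, fderiv ℝ (fun y : EuclideanSpace ℝ (Fin 3) => Newtonian.regKernel
        ((((n : ℝ) + 1)⁻¹) ^ 2) (y - x₀)) x (stdOrthonormalBasis ℝ (EuclideanSpace ℝ (Fin 3)) i) *
        fderiv ℝ (χ n) x (stdOrthonormalBasis ℝ (EuclideanSpace ℝ (Fin 3)) i)) * G x| ≤
        3 * C₁ * B * ∫ x : EuclideanSpace ℝ (Fin 3), ((1 + ‖x‖) ^ 4)⁻¹) ∧
      ∀ n : ℕ, Integrable (fun x => (∑ i, fderiv ℝ (fun y : EuclideanSpace ℝ (Fin 3) =>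
        Newtonian.regKernel ((((n : ℝ) + 1)⁻¹) ^ 2) (y - x₀)) x
        (stdOrthonormalBasis ℝ (EuclideanSpace ℝ (Fin 3)) i) *
        fderiv ℝ (χ n) x (stdOrthonormalBasis ℝ (EuclideanSpace ℝ (Fin 3)) i)) * G x) := by
  set b := stdOrthonormalBasis ℝ (EuclideanSpace ℝ (Fin 3)) with hb
  have hC₁ : 0 ≤ C₁ := by
    have h := (norm_nonneg _).trans (hχD 0 x₀)
    simp only [Nat.cast_zero, zero_add, div_one] at h
    exact h
  have hφ1 : ∀ n : ℕ, ContDiff ℝ 1 fun y : EuclideanSpace ℝ (Fin 3) => Newtonian.regKernel ((((n : ℝ) + 1)⁻¹) ^ 2) (y - x₀) :=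
    fun n => hardyPointSink_contDiff_weight (hardyPointSink_seq_pos n) x₀
  have hφDc : ∀ n : ℕ, Continuous (fderiv ℝ fun y : EuclideanSpace ℝ (Fin 3) =>
      Newtonian.regKernel ((((n : ℝ) + 1)⁻¹) ^ 2) (y - x₀)) := fun n =>
    (hφ1 n).continuous_fderiv one_ne_zero
  have hχDc : ∀ n, Continuous (fderiv ℝ (χ n)) := fun n => (hχc n).continuous_fderiv one_ne_zero
  have hmeas : ∀ n : ℕ, Continuous fun x => (∑ i, fderiv ℝ (fun y : EuclideanSpace ℝ (Fin 3) => Newtonian.regKernel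
      ((((n : ℝ) + 1)⁻¹) ^ 2) (y - x₀)) x (b i) * fderiv ℝ (χ n) x (b i)) * G x := fun n =>
    (continuous_finsetSum _ fun i _ =>
      ((hφDc n).clm_apply continuous_const).mul ((hχDc n).clm_apply continuous_const)).mul hG
  have key := hardyPointSink_dct_zero
    (F := fun n x => (∑ i, fderiv ℝ (fun y : EuclideanSpace ℝ (Fin 3) => Newtonian.regKernel
      ((((n : ℝ) + 1)⁻¹) ^ 2) (y - x₀)) x (b i) * fderiv ℝ (χ n) x (b i)) * G x)
    (bound := fun x => 3 * C₁ * B * ((1 + ‖x‖) ^ 4)⁻¹)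
    (fun n => (hmeas n).aestronglyMeasurable) (hardyPointSink_integrable_F0.const_mul _) ?_ ?_
  · rw [integral_const_mul] at key
    exact key
  · intro n
    refine Eventually.of_forall fun x => ?_
    have hB4 : 0 ≤ B * ((1 + ‖x‖) ^ 4)⁻¹ := (abs_nonneg _).trans (hGB x)
    by_cases hx : dist x x₀ < (n : ℝ) + 1
    · simp only [hχDz n x hx, zero_apply, mul_zero, Finset.sum_const_zero,
        zero_mul, norm_zero]
      have h := mul_nonneg (show (0 : ℝ) ≤ 3 * C₁ by positivity) hB4
      linarith [h]
    · have hr1 : 1 ≤ ‖x - x₀‖ := hardyPointSink_one_le_norm_sub (not_lt.mp hx)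
      have hx' : x - x₀ ≠ 0 := by
        intro h; rw [h, norm_zero] at hr1; linarith
      -- `‖Dφₙ(x)‖ ≤ 1` off the ball
      have hDφ : ‖fderiv ℝ (fun y : EuclideanSpace ℝ (Fin 3) => Newtonian.regKernel ((((n : ℝ) + 1)⁻¹) ^ 2) (y - x₀)) x‖
          ≤ 1 := by
        refine (hardyPointSink_norm_fderiv_weight_le (hardyPointSink_seq_pos n) x₀ x).trans ?_
        refine (hardyPointSink_rho_mul_norm_le (hardyPointSink_seq_pos n).le hx').trans ?_
        exact inv_le_one_of_one_le₀ (one_le_pow₀ hr1)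
      -- `‖Dχₙ(x)‖ ≤ C₁`
      have hDχ : ‖fderiv ℝ (χ n) x‖ ≤ C₁ := by
        refine (hχD n x).trans (div_le_self hC₁ ?_)
        have := (Nat.cast_nonneg n : (0 : ℝ) ≤ n); linarith
      have hterm : ∀ i, |fderiv ℝ (fun y : EuclideanSpace ℝ (Fin 3) => Newtonian.regKernel ((((n : ℝ) + 1)⁻¹) ^ 2)
          (y - x₀)) x (b i) * fderiv ℝ (χ n) x (b i)| ≤ 1 * C₁ := by
        intro i
        rw [abs_mul]
        refine mul_le_mul ?_ ?_ (abs_nonneg _) zero_le_one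
        · rw [← Real.norm_eq_abs]
          exact (Literature.Analysis.FluidPDE.norm_apply_orthonormalBasis_le b i _).trans hDφ
        · rw [← Real.norm_eq_abs]
          exact (Literature.Analysis.FluidPDE.norm_apply_orthonormalBasis_le b i _).trans hDχ
      have hsum : |∑ i, fderiv ℝ (fun y : EuclideanSpace ℝ (Fin 3) => Newtonian.regKernel ((((n : ℝ) + 1)⁻¹) ^ 2)
          (y - x₀)) x (b i) * fderiv ℝ (χ n) x (b i)| ≤ 3 * C₁ := by
        refine (Finset.abs_sum_le_sum_abs _ _).trans ?_
        calc ∑ i, |fderiv ℝ (fun y : EuclideanSpace ℝ (Fin 3) => Newtonian.regKernel ((((n : ℝ) + 1)⁻¹) ^ 2)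
              (y - x₀)) x (b i) * fderiv ℝ (χ n) x (b i)|
            ≤ ∑ _i : Fin (Module.finrank ℝ (EuclideanSpace ℝ (Fin 3))), 1 * C₁ := Finset.sum_le_sum fun i _ => hterm i
          _ = 3 * C₁ := by simp
      rw [Real.norm_eq_abs, abs_mul]
      calc |∑ i, fderiv ℝ (fun y : EuclideanSpace ℝ (Fin 3) => Newtonian.regKernel ((((n : ℝ) + 1)⁻¹) ^ 2)
            (y - x₀)) x (b i) * fderiv ℝ (χ n) x (b i)| * |G x|
          ≤ 3 * C₁ * (B * ((1 + ‖x‖) ^ 4)⁻¹) := mul_le_mul hsum (hGB x) (abs_nonneg _) (by positivity)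
        _ = 3 * C₁ * B * ((1 + ‖x‖) ^ 4)⁻¹ := by ring
  · intro x
    filter_upwards [hardyPointSink_eventually_dist_lt x₀ x] with n hn
    simp only [hχDz n x hn, zero_apply, mul_zero, Finset.sum_const_zero,
      zero_mul]

/-! ### The cut-off Laplacian term -/

/-- **The cut-off Laplacian term vanishes**: `∫ Δχₙ φₙ G → 0`, uniform bound `C₂ B ∫ (1+‖x‖)⁻⁴`,
where `|Δχₙ| ≤ C₂/(n+1)²` and `Δχₙ = 0` on `B(x₀, n+1)`. -/
theorem hardyPointSink_tendsto_lap_cutoff_term (x₀ : EuclideanSpace ℝ (Fin 3))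
    {χ : ℕ → (EuclideanSpace ℝ (Fin 3)) → ℝ}
    (hχc : ∀ n, ContDiff ℝ 2 (χ n)) {C₂ : ℝ}
    (hχL : ∀ (n : ℕ) (x : EuclideanSpace ℝ (Fin 3)), |(Δ (χ n)) x| ≤ C₂ / ((n : ℝ) + 1) ^ 2)
    (hχLz : ∀ (n : ℕ) (x : EuclideanSpace ℝ (Fin 3)), dist x x₀ < (n : ℝ) + 1 → (Δ (χ n)) x = 0)
    {G : (EuclideanSpace ℝ (Fin 3)) → ℝ} (hG : Continuous G) {B : ℝ}
    (hGB : ∀ x, |G x| ≤ B * ((1 + ‖x‖) ^ 4)⁻¹) :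
    Tendsto (fun n : ℕ => ∫ x, (Δ (χ n)) x * Newtonian.regKernel ((((n : ℝ) + 1)⁻¹) ^ 2) (x - x₀) *
        G x) atTop (𝓝 0) ∧
      (∀ n : ℕ, |∫ x, (Δ (χ n)) x * Newtonian.regKernel ((((n : ℝ) + 1)⁻¹) ^ 2) (x - x₀) * G x| ≤
        C₂ * B * ∫ x : EuclideanSpace ℝ (Fin 3), ((1 + ‖x‖) ^ 4)⁻¹) ∧
      ∀ n : ℕ, Integrable (fun x => (Δ (χ n)) x *
        Newtonian.regKernel ((((n : ℝ) + 1)⁻¹) ^ 2) (x - x₀) * G x) := by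
  have hC₂ : 0 ≤ C₂ := by
    have h := (abs_nonneg _).trans (hχL 0 x₀)
    simp only [Nat.cast_zero, zero_add, one_pow, div_one] at h
    exact h
  have hφc : ∀ n : ℕ, Continuous fun x : EuclideanSpace ℝ (Fin 3) => Newtonian.regKernel ((((n : ℝ) + 1)⁻¹) ^ 2) (x - x₀) :=
    fun n => (hardyPointSink_contDiff_weight (hardyPointSink_seq_pos n) x₀ (m := 0)).continuous
  have hLc : ∀ n, Continuous (Δ (χ n)) := fun n =>
    Literature.Analysis.FluidPDE.continuous_laplacian (hχc n)
  have key := hardyPointSink_dct_zero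
    (F := fun n x => (Δ (χ n)) x * Newtonian.regKernel ((((n : ℝ) + 1)⁻¹) ^ 2) (x - x₀) * G x)
    (bound := fun x => C₂ * B * ((1 + ‖x‖) ^ 4)⁻¹)
    (fun n => (((hLc n).mul (hφc n)).mul hG).aestronglyMeasurable)
    (hardyPointSink_integrable_F0.const_mul _) ?_ ?_
  · rw [integral_const_mul] at key
    exact key
  · intro n
    refine Eventually.of_forall fun x => ?_
    have hB4 : 0 ≤ B * ((1 + ‖x‖) ^ 4)⁻¹ := (abs_nonneg _).trans (hGB x)
    by_cases hx : dist x x₀ < (n : ℝ) + 1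
    · rw [hχLz n x hx, zero_mul, zero_mul, norm_zero]
      have h := mul_nonneg hC₂ hB4
      linarith [h]
    · have hr1 : 1 ≤ ‖x - x₀‖ := hardyPointSink_one_le_norm_sub (not_lt.mp hx)
      have hx' : x - x₀ ≠ 0 := by
        intro h; rw [h, norm_zero] at hr1; linarith
      have hφ0 : 0 ≤ Newtonian.regKernel ((((n : ℝ) + 1)⁻¹) ^ 2) (x - x₀) :=
        hardyPointSink_regKernel_nonneg (hardyPointSink_seq_pos n).le _
      have hφ1 : Newtonian.regKernel ((((n : ℝ) + 1)⁻¹) ^ 2) (x - x₀) ≤ 1 :=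
        (hardyPointSink_regKernel_le_inv_norm (hardyPointSink_seq_pos n).le hx').trans
          (inv_le_one_of_one_le₀ hr1)
      have hL : |(Δ (χ n)) x| ≤ C₂ := by
        refine (hχL n x).trans (div_le_self hC₂ ?_)
        have := (Nat.cast_nonneg n : (0 : ℝ) ≤ n)
        nlinarith
      rw [Real.norm_eq_abs, abs_mul, abs_mul, abs_of_nonneg hφ0]
      calc |(Δ (χ n)) x| * Newtonian.regKernel ((((n : ℝ) + 1)⁻¹) ^ 2) (x - x₀) * |G x|
          ≤ C₂ * 1 * (B * ((1 + ‖x‖) ^ 4)⁻¹) :=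
            mul_le_mul (mul_le_mul hL hφ1 hφ0 hC₂) (hGB x) (abs_nonneg _) (by positivity)
        _ = C₂ * B * ((1 + ‖x‖) ^ 4)⁻¹ := by ring
  · intro x
    filter_upwards [hardyPointSink_eventually_dist_lt x₀ x] with n hn
    rw [hχLz n x hn, zero_mul, zero_mul]

/-! ### The cut-off gradient term -/

/-- **The cut-off gradient term vanishes**: `∫ φₙ Dχₙ(v) S → 0`, uniform bound
`2 C₁ C B ∫ (1+‖x‖)⁻²|x - x₀|⁻²`, where `‖Dχₙ‖ ≤ C₁/(n+1)`, `Dχₙ = 0` on `B(x₀, n+1)` and off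
`B̄(x₀, 2(n+1))`, `‖v‖ ≤ C(1+‖x‖)⁻²`, `|S| ≤ B`. -/
theorem hardyPointSink_tendsto_grad_cutoff_term (x₀ : EuclideanSpace ℝ (Fin 3))
    {χ : ℕ → (EuclideanSpace ℝ (Fin 3)) → ℝ}
    (hχc : ∀ n, ContDiff ℝ 1 (χ n)) {C₁ : ℝ}
    (hχD : ∀ (n : ℕ) (x : EuclideanSpace ℝ (Fin 3)), ‖fderiv ℝ (χ n) x‖ ≤ C₁ / ((n : ℝ) + 1))
    (hχDz : ∀ (n : ℕ) (x : EuclideanSpace ℝ (Fin 3)), dist x x₀ < (n : ℝ) + 1 → fderiv ℝ (χ n) x = 0)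
    (hχDz' : ∀ (n : ℕ) (x : EuclideanSpace ℝ (Fin 3)), 2 * ((n : ℝ) + 1) < dist x x₀ → fderiv ℝ (χ n) x = 0)
    {v : (EuclideanSpace ℝ (Fin 3)) → (EuclideanSpace ℝ (Fin 3))} (hv : Continuous v) {C : ℝ}
    (hvC : ∀ x, ‖v x‖ ≤ C * ((1 + ‖x‖) ^ 2)⁻¹)
    {S : (EuclideanSpace ℝ (Fin 3)) → ℝ} (hS : Continuous S) {B : ℝ} (hSB : ∀ x, |S x| ≤ B) :
    Tendsto (fun n : ℕ => ∫ x, Newtonian.regKernel ((((n : ℝ) + 1)⁻¹) ^ 2) (x - x₀) *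
        fderiv ℝ (χ n) x (v x) * S x) atTop (𝓝 0) ∧
      (∀ n : ℕ, |∫ x, Newtonian.regKernel ((((n : ℝ) + 1)⁻¹) ^ 2) (x - x₀) *
        fderiv ℝ (χ n) x (v x) * S x| ≤
        2 * C₁ * C * B * ∫ x : EuclideanSpace ℝ (Fin 3), ((1 + ‖x‖) ^ 2)⁻¹ * (‖x - x₀‖ ^ 2)⁻¹) ∧
      ∀ n : ℕ, Integrable (fun x => Newtonian.regKernel ((((n : ℝ) + 1)⁻¹) ^ 2) (x - x₀) *
        fderiv ℝ (χ n) x (v x) * S x) := by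
  have hC₁ : 0 ≤ C₁ := by
    have h := (norm_nonneg _).trans (hχD 0 x₀)
    simp only [Nat.cast_zero, zero_add, div_one] at h
    exact h
  have hC : 0 ≤ C := by
    have h := (norm_nonneg _).trans (hvC x₀)
    have h' : 0 < ((1 + ‖x₀‖) ^ 2)⁻¹ := by positivity
    nlinarith
  have hB : 0 ≤ B := (abs_nonneg _).trans (hSB x₀)
  have hφc : ∀ n : ℕ, Continuous fun x : EuclideanSpace ℝ (Fin 3) => Newtonian.regKernel ((((n : ℝ) + 1)⁻¹) ^ 2) (x - x₀) :=
    fun n => (hardyPointSink_contDiff_weight (hardyPointSink_seq_pos n) x₀ (m := 0)).continuous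
  have hχDc : ∀ n, Continuous (fderiv ℝ (χ n)) := fun n => (hχc n).continuous_fderiv one_ne_zero
  have key := hardyPointSink_dct_zero
    (F := fun n x => Newtonian.regKernel ((((n : ℝ) + 1)⁻¹) ^ 2) (x - x₀) *
      fderiv ℝ (χ n) x (v x) * S x)
    (bound := fun x => 2 * C₁ * C * B * (((1 + ‖x‖) ^ 2)⁻¹ * (‖x - x₀‖ ^ 2)⁻¹))
    (fun n => (((hφc n).mul ((hχDc n).clm_apply hv)).mul hS).aestronglyMeasurable)
    ((hardyPointSink_integrable_FC x₀).const_mul _) ?_ ?_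
  · rw [integral_const_mul] at key
    exact key
  · intro n
    refine Eventually.of_forall fun x => ?_
    have hbd : 0 ≤ 2 * C₁ * C * B * (((1 + ‖x‖) ^ 2)⁻¹ * (‖x - x₀‖ ^ 2)⁻¹) := by positivity
    by_cases hx : dist x x₀ < (n : ℝ) + 1
    · rw [hχDz n x hx, zero_apply, mul_zero, zero_mul, norm_zero]
      exact hbd
    by_cases hx2 : 2 * ((n : ℝ) + 1) < dist x x₀
    · rw [hχDz' n x hx2, zero_apply, mul_zero, zero_mul, norm_zero]
      exact hbd
    -- on the annulus `n+1 ≤ ‖x - x₀‖ ≤ 2(n+1)`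
    rw [not_lt] at hx hx2
    have hr1 : 1 ≤ ‖x - x₀‖ := hardyPointSink_one_le_norm_sub hx
    have hr : 0 < ‖x - x₀‖ := by linarith
    have hx' : x - x₀ ≠ 0 := norm_pos_iff.1 hr
    have hn1 : (0 : ℝ) < (n : ℝ) + 1 := by positivity
    have hφ0 : 0 ≤ Newtonian.regKernel ((((n : ℝ) + 1)⁻¹) ^ 2) (x - x₀) :=
      hardyPointSink_regKernel_nonneg (hardyPointSink_seq_pos n).le _
    have hφ1 : Newtonian.regKernel ((((n : ℝ) + 1)⁻¹) ^ 2) (x - x₀) ≤ ‖x - x₀‖⁻¹ :=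
      hardyPointSink_regKernel_le_inv_norm (hardyPointSink_seq_pos n).le hx'
    -- `‖Dχₙ(x)‖ ≤ C₁/(n+1) ≤ 2 C₁ / ‖x - x₀‖`
    have hDχ : ‖fderiv ℝ (χ n) x‖ ≤ 2 * C₁ * ‖x - x₀‖⁻¹ := by
      refine (hχD n x).trans ?_
      rw [dist_eq_norm] at hx2
      rw [div_le_iff₀ hn1]
      have h1 : C₁ * ‖x - x₀‖ ≤ 2 * C₁ * ((n : ℝ) + 1) := by nlinarith
      calc C₁ = C₁ * ‖x - x₀‖ * ‖x - x₀‖⁻¹ := by field_simp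
        _ ≤ 2 * C₁ * ((n : ℝ) + 1) * ‖x - x₀‖⁻¹ :=
            mul_le_mul_of_nonneg_right h1 (inv_nonneg.2 hr.le)
        _ = 2 * C₁ * ‖x - x₀‖⁻¹ * ((n : ℝ) + 1) := by ring
    have h1 : |fderiv ℝ (χ n) x (v x)| ≤ 2 * C₁ * ‖x - x₀‖⁻¹ * (C * ((1 + ‖x‖) ^ 2)⁻¹) := by
      rw [← Real.norm_eq_abs]
      calc ‖fderiv ℝ (χ n) x (v x)‖ ≤ ‖fderiv ℝ (χ n) x‖ * ‖v x‖ :=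
            ContinuousLinearMap.le_opNorm _ _
        _ ≤ 2 * C₁ * ‖x - x₀‖⁻¹ * (C * ((1 + ‖x‖) ^ 2)⁻¹) :=
            mul_le_mul hDχ (hvC x) (norm_nonneg _) (by positivity)
    rw [Real.norm_eq_abs, abs_mul, abs_mul, abs_of_nonneg hφ0]
    calc Newtonian.regKernel ((((n : ℝ) + 1)⁻¹) ^ 2) (x - x₀) * |fderiv ℝ (χ n) x (v x)| * |S x|
        ≤ ‖x - x₀‖⁻¹ * (2 * C₁ * ‖x - x₀‖⁻¹ * (C * ((1 + ‖x‖) ^ 2)⁻¹)) * B :=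
          mul_le_mul (mul_le_mul hφ1 h1 (abs_nonneg _) (inv_nonneg.2 hr.le)) (hSB x)
            (abs_nonneg _) (by positivity)
      _ = 2 * C₁ * C * B * (((1 + ‖x‖) ^ 2)⁻¹ * (‖x - x₀‖ ^ 2)⁻¹) := by
          rw [sq (‖x - x₀‖), mul_inv]; ring
  · intro x
    filter_upwards [hardyPointSink_eventually_dist_lt x₀ x] with n hn
    rw [hχDz n x hn, zero_apply, mul_zero, zero_mul]

end Summit.NavierStokesRegularity.NavierStokesRegularity.Theorems

end
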